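import Summits.ResolutionOfSingularities.ResolutionOfSingularities.Theorems.PurelyInseparableDim4ColengthCert
import Summits.ResolutionOfSingularities.ResolutionOfSingularities.Theorems.PurelyInseparableDim4JetColength
import HarnessLib
import HarnessLib.Audit.Tags

/-!
# Colength LOWER bounds by dual functionals: `|B| ≤ μ⁺`, `decide`-able (cell `res-dim4-pi`, p-7 g2 (ι*))

[OURS · counted 0 · instrument] Nothing here is a statement about resolution of singularities;
resolution in dimension `≥ 4` / characteristic `p > 0` is NOT proved by anything in this file.

res-dim4-p-8 g2's kit `PurelyInseparableDim4ColengthCert` certifies isolation and the UPPER bound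
`μ⁺ = jetColength q N F ≤ |B|` (spanning monomials).  This file adds the LOWER bound, so that the cell
can book EXACT `μ⁺` rows ‖ K (and, first consumer, a wide edge on which `μ⁺` does NOT drop):

* §1 `lamL Λ` — the `K`-linear functional on `K[x₁..x₄]` presented by a value list `Λ : Terms 4 K`
  (`λ(x^e) = coeffAt Λ e`); `pairT Λ T = λ(evalT T)` computed on lists (`lamL_evalT`).
* §2 `degLTB N Λ` (values only in degree `< N`, so `λ` kills `𝔪₀ᴺ`) and `killsB q N L Λ` (`λ` kills every
  `x^m · D^{(α)}(evalT L)`, `deg m < N`, `0 < |α| < q`); soundness **`lamL_eq_zero_of_mem_sup`**: such a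
  `λ` vanishes on `J_q⁺(evalT L) + 𝔪₀ᴺ`.
* §3 **`dualCertB q N L D`** for a list `D` of pairs (monomial `b`, functional `Λ_b`): every `Λ_b` passes
  §2, `Λ_b(x^b) = 1`, `Λ_b(x^{b'}) = 0` for the other listed monomials, no monomial listed twice; soundness
  **`length_le_jetColength_of_dualCertB : dualCertB q N L D = true → D.length ≤ jetColength q N (evalT L)`**
  — the classes of the `x^b` are linearly independent in the FINITE quotient `K[x] ⧸ (J_q⁺ + 𝔪₀ᴺ)`
  (`IsolationCert.moduleFinite_quotient_of_originIdeal_pow_le`), witnessed by the `λ_b`.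

All checks are structural recursions on lists settled by `decide` on explicit data; the functionals are
found OFF-tree (linear algebra over `𝔽_p`) and only CHECKED here.  bears_on: LADDER-RESOLUTION:D157-DOOR2
(res-dim4-pi · μ⁺ rows ‖ K · wide core).  Supports stmt-ResolutionOfSingularities-16155 (helper).
-/

set_option linter.dupNamespace false -- mandated namespace of this single-conjunct summit

noncomputable section

open MvPolynomial Finset
open scoped BigOperators

namespace Summit.ResolutionOfSingularities.ResolutionOfSingularities.Theorems.PIDim4

namespace ColengthCert

open StepKit ScopeCover ScopeBlind
open Literature.AlgebraicGeometry.Resolution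

variable {K : Type} [Field K]

/-! ## §1 Functionals presented by value lists -/

/-- **The functional of a value list**: `λ_Λ(G) = Σ_{(e, c) ∈ Λ} c · coeff_{x^e} G`, a `K`-linear map
`K[x₁..x₄] → K` (so `λ_Λ(x^e) = coeffAt Λ e`). [folklore] -/
def lamL (Λ : Terms 4 K) : MvPolynomial (Fin 4) K →ₗ[K] K :=
  (Λ.map fun t => t.2 • MvPolynomial.lcoeff K (expo t.1)).sum

/-- `λ_Λ(G)` unfolded as a list sum. [folklore] -/
theorem lamL_apply (Λ : Terms 4 K) (G : MvPolynomial (Fin 4) K) :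
    lamL Λ G = (Λ.map fun t => t.2 * coeff (expo t.1) G).sum := by
  induction Λ with
  | nil => simp [lamL]
  | cons t Λ ih =>
    simp only [lamL, List.map_cons, List.sum_cons, LinearMap.add_apply, LinearMap.smul_apply,
      MvPolynomial.lcoeff_apply, smul_eq_mul] at ih ⊢
    rw [ih]

/-- **`λ_Λ` on a monomial**: `λ_Λ(c · x^e) = c · coeffAt Λ e`. [folklore] -/
theorem lamL_monomial (Λ : Terms 4 K) (e : Fin 4 → ℕ) (c : K) :
    lamL Λ (monomial (expo e) c) = c * coeffAt Λ e := by
  induction Λ with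
  | nil => simp [lamL, coeffAt]
  | cons t Λ ih =>
    simp only [lamL, List.map_cons, List.sum_cons, LinearMap.add_apply, LinearMap.smul_apply,
      MvPolynomial.lcoeff_apply, smul_eq_mul] at ih ⊢
    rw [ih, coeffAt, coeff_monomial, mul_add]
    congr 1
    by_cases h : t.1 = e
    · rw [if_pos (congrArg expo h).symm, if_pos h, mul_comm]
    · rw [if_neg (fun h' => h (expo_inj.mp h'.symm)), if_neg h, mul_zero, mul_zero]

/-- The pairing of a value list with a term list: `Σ_{(e, c) ∈ T} c · coeffAt Λ e`. [folklore] -/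
def pairT (Λ T : Terms 4 K) : K := (T.map fun t => t.2 * coeffAt Λ t.1).sum

/-- **Transfer**: `λ_Λ(evalT T) = pairT Λ T`. [folklore] -/
theorem lamL_evalT (Λ T : Terms 4 K) : lamL Λ (evalT T) = pairT Λ T := by
  induction T with
  | nil => simp [pairT]
  | cons t T ih =>
    rw [evalT_cons, map_add, lamL_monomial, ih]
    simp [pairT]

/-! ## §2 Functionals killing `J_q⁺ + 𝔪₀ᴺ` -/

/-- Every value of the list sits in degree `< N`. [folklore] -/
def degLTB {R : Type} (N : ℕ) (Λ : Terms 4 R) : Bool := Λ.all fun t => decide (∑ i, t.1 i < N)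

/-- A functional with values in degree `< N` kills `𝔪₀ᴺ`. [folklore] -/
theorem lamL_eq_zero_of_mem_pow {N : ℕ} {Λ : Terms 4 K} (hdeg : degLTB N Λ = true)
    {G : MvPolynomial (Fin 4) K} (hG : G ∈ originIdeal K ^ N) : lamL Λ G = 0 := by
  rw [IsolationCert.mem_originIdeal_pow_iff] at hG
  simp only [degLTB, List.all_eq_true, decide_eq_true_eq] at hdeg
  rw [lamL_apply]
  refine List.sum_eq_zero fun x hx => ?_
  rw [List.mem_map] at hx
  obtain ⟨t, ht, rfl⟩ := hx
  rw [hG (expo t.1) (by rw [degree_expo]; exact hdeg t ht), mul_zero]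

/-- **`λ` kills every `x^m · D^{(α)}(evalT L)`**, `deg m < N`, `0 < |α| < q`, as a Boolean check.
[folklore] -/
def killsB [DecidableEq K] (q N : ℕ) (L Λ : Terms 4 K) : Bool :=
  (idxLT q).all fun α => (monosLT N).all fun m => decide (pairT Λ (mulL [(m, 1)] (hasseL α L)) = 0)

/-- A functional passing `degLTB`/`killsB` kills `x^m · D^{(α)}(evalT L)` for EVERY monomial `m`
(those of degree `≥ N` land in `𝔪₀ᴺ`). [cite: Giraud1975, §1 (Hasse–Schmidt derivations)] -/
theorem lamL_monomial_mul_hasseDeriv_eq_zero [DecidableEq K] {q N : ℕ} {L Λ : Terms 4 K}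
    (hdeg : degLTB N Λ = true) (hkill : killsB q N L Λ = true) (m : Fin 4 →₀ ℕ) (c : K)
    {α : Fin 4 →₀ ℕ} (h0 : 0 < α.degree) (hq : α.degree < q) :
    lamL Λ (monomial m c * hasseDeriv α (evalT L)) = 0 := by
  by_cases hm : m.degree < N
  · simp only [killsB, List.all_eq_true, decide_eq_true_eq] at hkill
    have h := hkill (⇑α) (mem_idxLT h0 hq) (⇑m) (mem_monosLT hm)
    rw [← lamL_evalT, evalT_mulL, ← hasseDeriv_evalT, expo_coe, evalT_cons, evalT_nil, add_zero,
      expo_coe] at h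
    have hc : monomial m c * hasseDeriv α (evalT L) = c • (monomial m 1 * hasseDeriv α (evalT L)) := by
      rw [← smul_mul_assoc, smul_monomial, smul_eq_mul, mul_one]
    rw [hc, map_smul, h, smul_zero]
  · refine lamL_eq_zero_of_mem_pow hdeg (Ideal.mul_mem_right _ _ ?_)
    rw [IsolationCert.mem_originIdeal_pow_iff]
    intro d hd
    rw [coeff_monomial, if_neg]
    rintro rfl
    exact hm hd

/-- **Soundness of §2**: a functional passing `degLTB N` and `killsB q N L` vanishes on
`J_q⁺(evalT L) + 𝔪₀ᴺ`.  (`J_q⁺ = ⟨D^{(α)}F⟩`; a multiple `r · D^{(α)}F` is the finite `K`-combination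
`Σ_m coeff_m(r) · x^m D^{(α)}F`.) [cite: AtiyahMacdonald1969, Ch. 1 (ideal generated by a set)] -/
theorem lamL_eq_zero_of_mem_sup [DecidableEq K] {q N : ℕ} {L Λ : Terms 4 K} (hdeg : degLTB N Λ = true)
    (hkill : killsB q N L Λ = true) {G : MvPolynomial (Fin 4) K}
    (hG : G ∈ singLocusIdeal q (evalT L) ⊔ originIdeal K ^ N) : lamL Λ G = 0 := by
  obtain ⟨a, ha, r, hr, rfl⟩ := Submodule.mem_sup.mp hG
  rw [map_add, lamL_eq_zero_of_mem_pow hdeg hr, add_zero]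
  -- `λ(r · a) = 0` for every `r`, by span induction on `a ∈ J_q⁺`
  suffices h : ∀ r : MvPolynomial (Fin 4) K, lamL Λ (r * a) = 0 by
    simpa using h 1
  rw [singLocusIdeal] at ha
  refine Submodule.span_induction (p := fun a _ => ∀ r : MvPolynomial (Fin 4) K, lamL Λ (r * a) = 0)
    ?_ ?_ ?_ ?_ ha
  · rintro _ ⟨α, h0, hq, rfl⟩ r
    rw [r.as_sum, Finset.sum_mul, map_sum]
    exact Finset.sum_eq_zero fun d _ => lamL_monomial_mul_hasseDeriv_eq_zero hdeg hkill d _ h0 hq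
  · intro r
    rw [mul_zero, map_zero]
  · intro x y _ _ hx hy r
    rw [mul_add, map_add, hx, hy, add_zero]
  · intro s x _ hx r
    rw [smul_eq_mul, ← mul_assoc]
    exact hx (r * s)

/-! ## §3 The dual certificate: `|D| ≤ μ⁺` -/

/-- One dual row for the pair `d = (b, Λ_b)` against the whole list `D`: `Λ_b` has values in degree `< N`,
kills `J_q⁺ + 𝔪₀ᴺ`, takes the value `1` on `x^b` and `0` on every other listed monomial. [folklore] -/
def dualRowB [DecidableEq K] (q N : ℕ) (L : Terms 4 K) (D : List ((Fin 4 → ℕ) × Terms 4 K))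
    (d : (Fin 4 → ℕ) × Terms 4 K) : Bool :=
  degLTB N d.2 && killsB q N L d.2 && decide (coeffAt d.2 d.1 = 1) &&
    D.all fun d' => decide (d'.1 = d.1) || decide (coeffAt d.2 d'.1 = 0)

/-- **The dual certificate check**: distinct monomials, one dual row each. [folklore] -/
def dualCertB [DecidableEq K] (q N : ℕ) (L : Terms 4 K) (D : List ((Fin 4 → ℕ) × Terms 4 K)) : Bool :=
  decide ((D.map Prod.fst).Nodup) && D.all (dualRowB q N L D)

/-- **Soundness (colength LOWER bound)**: `dualCertB` gives `|D| ≤ μ⁺ = jetColength q N (evalT L)` — the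
classes of the monomials `x^b`, `(b, Λ_b) ∈ D`, are linearly independent in the finite-dimensional
quotient `K[x] ⧸ (J_q⁺(evalT L) + 𝔪₀ᴺ)`: a relation `Σ c_b x^b ∈ J_q⁺ + 𝔪₀ᴺ` is killed by each `λ_b`,
which reads off `c_b = 0`. [cite: AtiyahMacdonald1969, Prop. 6.9 (length is additive)] -/
theorem length_le_jetColength_of_dualCertB [DecidableEq K] {q N : ℕ} {L : Terms 4 K}
    {D : List ((Fin 4 → ℕ) × Terms 4 K)} (h : dualCertB q N L D = true) :
    D.length ≤ RidgeBudget.jetColength q N (evalT L) := by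
  classical
  simp only [dualCertB, Bool.and_eq_true, decide_eq_true_eq, List.all_eq_true] at h
  obtain ⟨hnodup, hrows⟩ := h
  set I := singLocusIdeal q (evalT L) ⊔ originIdeal K ^ N with hI
  haveI : Module.Finite K (MvPolynomial (Fin 4) K ⧸ I) :=
    IsolationCert.moduleFinite_quotient_of_originIdeal_pow_le (I := I) (n := N) le_sup_right
  -- the candidate basis vectors and the map from coordinates
  set v : Fin D.length → MvPolynomial (Fin 4) K ⧸ I :=
    fun j => Ideal.Quotient.mkₐ K I (monomial (expo (D.get j).1) 1) with hv
  set ψ : (Fin D.length → K) →ₗ[K] MvPolynomial (Fin 4) K ⧸ I := Fintype.linearCombination K v with hψ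
  -- row facts
  have hrow : ∀ i : Fin D.length, degLTB N (D.get i).2 = true ∧ killsB q N L (D.get i).2 = true ∧
      coeffAt (D.get i).2 (D.get i).1 = 1 ∧
      ∀ j : Fin D.length, j ≠ i → coeffAt (D.get i).2 (D.get j).1 = 0 := by
    intro i
    have h := hrows (D.get i) (List.get_mem D i)
    simp only [dualRowB, Bool.and_eq_true, decide_eq_true_eq, List.all_eq_true, Bool.or_eq_true] at h
    obtain ⟨⟨⟨h1, h2⟩, h3⟩, h4⟩ := h
    refine ⟨h1, h2, h3, fun j hj => ?_⟩
    rcases h4 (D.get j) (List.get_mem D j) with h5 | h5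
    · exfalso
      apply hj
      have hinj : Function.Injective (fun k : Fin D.length => (D.map Prod.fst).get
          (Fin.cast (List.length_map _).symm k)) :=
        fun k k' hkk' => Fin.cast_injective _ (List.nodup_iff_injective_get.mp hnodup hkk')
      apply hinj
      simp only [List.get_eq_getElem, Fin.val_cast, List.getElem_map]
      exact h5
    · exact h5
  -- `ψ` is injective
  have hinj : Function.Injective ψ := by
    rw [← LinearMap.ker_eq_bot, LinearMap.ker_eq_bot']
    intro c hc
    rw [hψ, Fintype.linearCombination_apply] at hc
    have hmem : ∑ j, c j • monomial (expo (D.get j).1) (1 : K) ∈ I := by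
      rw [← Ideal.Quotient.eq_zero_iff_mem, ← Ideal.Quotient.mkₐ_eq_mk K, map_sum]
      simpa only [map_smul, hv] using hc
    funext i
    obtain ⟨h1, h2, h3, h4⟩ := hrow i
    have hz := lamL_eq_zero_of_mem_sup h1 h2 hmem
    rw [map_sum] at hz
    rw [Finset.sum_eq_single i] at hz
    · rw [map_smul, lamL_monomial, one_mul, h3, smul_eq_mul, mul_one] at hz
      rw [hz, Pi.zero_apply]
    · intro j _ hj
      rw [map_smul, lamL_monomial, one_mul, h4 j hj, smul_zero]
    · intro hi
      exact absurd (Finset.mem_univ i) hi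
  have hle := LinearMap.finrank_le_finrank_of_injective hinj
  rw [Module.finrank_fin_fun] at hle
  unfold RidgeBudget.jetColength
  rw [← hI]
  exact hle

/-- The lower bound for a presented state `s : SData 4 K`. [folklore] -/
theorem length_le_jetColength_toState_of_dualCertB [DecidableEq K] {q N : ℕ} {s : SData 4 K}
    {D : List ((Fin 4 → ℕ) × Terms 4 K)} (h : dualCertB q N s.L D = true) :
    D.length ≤ RidgeBudget.jetColength q N s.toState.F :=
  length_le_jetColength_of_dualCertB h

/-- **Exact `μ⁺` row** from the two certificates (p-8 g2's spanning rows + the dual rows here).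
[cite: AtiyahMacdonald1969, Prop. 6.9 (length is additive)] -/
theorem jetColength_eq_of_certs [DecidableEq K] {q N : ℕ} {L : Terms 4 K} {B : List (Fin 4 → ℕ)}
    {cert : List ((Fin 4 → ℕ) × List K × Row K)} {D : List ((Fin 4 → ℕ) × Terms 4 K)}
    (hup : colengthCertB q N L B cert = true) (hlow : dualCertB q N L D = true)
    (hlen : B.length = D.length) : RidgeBudget.jetColength q N (evalT L) = D.length :=
  le_antisymm (hlen ▸ jetColength_le_of_colengthCertB hup) (length_le_jetColength_of_dualCertB hlow)

end ColengthCert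

end Summit.ResolutionOfSingularities.ResolutionOfSingularities.Theorems.PIDim4

end
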